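import Summits.BirchSwinnertonDyer.Rank1Residual.X4.KuriharaLowerHalf
import Summits.BirchSwinnertonDyer.Rank1Residual.X5.TwoAdicTargetsEisenstein
import Summits.BirchSwinnertonDyer.Rank1Residual.X5.TwoAdicTargetsPub
import Summits.BirchSwinnertonDyer.BirchSwinnertonDyer.Theses.ByReductionTypeAtTwo
import Summits.BirchSwinnertonDyer.BirchSwinnertonDyer.Theorems.Rank1ResidualX1Defs
import Literature.NumberTheory.EllipticCurves.IwasawaAlgebraCharIdealProofs
import Literature.NumberTheory.EllipticCurves.TwoAdicImageGoodOrdinaryAtTwoProofs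
import HarnessLib

/-!
# Crux `OrdMissingLowerBoundAtTwo` (stmt-BirchSwinnertonDyer-19577, K4 route `ByReductionTypeAtTwo`) —
# line `lambda-kolyvagin-rigidity-two` (skeleton v1, crux-ideate 1/2 GEN 4, 2026-08-28; NOT registered:
# the ideator does not lead — `ledger skeleton check --crux` is the lead's call after triage)

IDEA (card `Ideas/lambda-kolyvagin-rigidity-two.md`, r4; absorbs `Ideas/kurihara-genus-identity-two.md` as the
first rung of `stub_supply`, per both triagers TRIAGE-r1-1 / TRIAGE-r1-2).  The crux is the Ш-LOWER (Eisenstein)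
half of BSD₂ at analytic rank 0, good ordinary 2: `ord₂ #Ш_an ≤ ord₂ #Ш[2^∞]`, for which every printed engine says
«p odd» (Skinner–Urban, Greenberg–Vatsal, Kato 17.4 (3), Mazur–Rubin, Kim; barrier
`Literature.Barriers.BirchSwinnertonDyer.IwasawaTheoryAtTwo`).  LEVER: on the BIG-IMAGE habitat (α)
(`ρ̄_{E,4}` onto ⟺ `ρ_{E,2^∞}` onto at a good ordinary 2, `habitat_iff` below = Dokchitser–Dokchitser 2012)
run the Mazur–Rubin/Kim argument for Kato's Λ-adic Kolyvagin system of `T₂E` UP TO BOUNDED INDEX: Kato's class is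
`d·κ′` with `κ′` primitive and `d ∈ Λ = ℤ₂⟦T⟧` the divisibility defect, so that `char X · (d) = (ϖ·L₂(E))`; ONE finite
certificate — a SHARP Kurihara witness `δ^{(c)}_n ≢ 0 (mod 2^k)` at Kim's level `k = ord₂ Tam + ord₂ c + 1`,
`n` a square-free product of level-`k` Kolyvagin primes whose Frobenius is a TRANSPOSITION on `E[2]` — forces
`d(0) ∈ ℤ₂ˣ`, i.e. `d ∈ Λˣ`, i.e. the full Néron-normalised main conjecture `MazurMainConjecture W 2`, whence the crux
through the in-tree X5 doors (`mainConjectureEisensteinDivisibilityAtTwo_of_mazurMainConjecture`,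
`missingLowerBoundAt_two_of_eisenstein_of_kato`, `twoAdicEulerCharRankZero_zero_of_greenberg`).  Every `p = 2`
pathology of the machine (`H¹(ℚ(E[4])/ℚ, E[4]) = 𝔽₂` — `CheckH1GL2Z4.lean`; `2` anomalous; `E(ℚ₂)[2]`; the real
place; half-integral plus symbols) is `O(1)` uniformly in the cyclotomic tower, and bounded index is invisible to
`char_Λ` — that is the bet, typed as `stub_witnessForcesUnit`.

STUBS (5) — what is load-bearing, what is imported, what is residual:
* `stub_pub`               — PRINT, BY NAME: K4 item 19149 `OrdPublishedInputsAtTwo` (modularity, GZK, Kato 17.4 (1)(2)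
                             at every prime incl. 2, Greenberg 4.1 at 2).  Never proved in the line.
* `stub_offBigImage`       — RESIDUAL (honest restriction of the crux OFF the habitat: `ρ̄_{E,4}` not onto = strata
                             (β) rational 2-torsion ∪ (γ₁) `C₃`-image ∪ (γ₂) `Δ ∈ −ℚ^{×2}` of `offHabitat_cases_of_goodOrd_two`).
                             NOT this line's lever: owned by the sandwich line (`Lines/kato_free_lower_sandwich_two.lean`,
                             μ-witness + λ-half), GV-analytic-two / EisensteinDepletionAtTwo (β), theta-anchor-two and
                             dihedral-prime-two-disc-field (γ₁, γ₂: Δ < 0 there), and — for (γ₂) only — the BUDGET form of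
                             this lever (Frob-trivial primes admitted, one level each; card §Transfer).  A lead may swap it
                             for the sandwich pair; the composition only needs `MissingLowerBoundAt W 2` off (α).
* `stub_katoCofactor`      — BOOKED, NOT SMUGGLED (triage-2 price (b)): Kato's divisibility `char X ∣ ϖ·L₂` INTEGRALLY in Λ
                             at `W` on (α) — the tree's typed object `X5.O1.MainConjectureLowerDivisibilityAtTwoOrd W`
                             (= K4 aside item 19271 / crux 19573 `stub_surj` weakened from `ρ̄₂ onto` to `ρ̄₄ onto`).
                             Kato 17.4 (3) prints `p ≠ 2` (12.5 (4) / 13.4 (3) lose a factor 2; 17.13 «exact up to ×2»);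
                             on (α) `ϖ ∈ ℤ₂ˣ` (`realPeriodRat_eq_unit_mul_plusPeriod_two`), so this is exactly «Kato's
                             Euler-system divisibility with 2-integral cofactor».  The MR machine proves it in passing
                             (structure theorem for the generator `κ′`); it is a separate stub so that the Kato half is
                             visible and shared with 19573's line, not hidden inside `stub_witnessForcesUnit`.
* `stub_witnessForcesUnit` — THE NEW LEVER (hardest, XL): with `char X = (f_X)` and `f_X · d ↦ ϖ·L₂`, a sharp witness
                             forces `IsUnit d`.  = Mazur–Rubin Thm 5.3.10(iii) + Kim §4–6 at `p = 2` with bounded defects: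
                             core rank `χ(T₂E, F_can) = 1` for both signs of `Δ` (v = 2: +2 − h⁰... = 1 net with v = ∞: −1;
                             real condition = Kummer image of `π₀(E(ℝ))`, finite-level `E(ℝ)/2^k`, self-dual — triage-2 (a));
                             (H.1) absolute irreducibility of `E[2]` holds on (α); (H.2) `τ = [[1,1],[0,1]] ∈ ρ(G_{ℚ(μ_{2^∞})})`
                             ⟺ (α) by `habitat_iff`; (H.3) fails by ONE class (`H¹(GL₂(ℤ/4), E[4]) = 𝔽₂`), visible at 12/12
                             level-2 Kolyvagin classes (finite check `CheckH1GL2Z4.lean`) ⇒ bounded; (H.4) 2-class general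
                             position holds except the parity-switch pair, 4-class version = the open one-page check.
                             Exactness of the Tamagawa floor (`KuriharaTamagawaFloorAtTwo`, rung r2′: no witness below
                             level `e + t + 1`; 0 violations in > 1000 numbers, kit j304439/j304479) is part of this stub.
* `stub_supply`            — ANALYTIC (conjecture-grade, decidable curve by curve): every rank-0 curve of (α) carries a
                             sharp witness (kit j304439/j304479: 28/28 on (α); the 29th test curve 2541a1 is (γ₂)).  First
                             rungs: r1 `TransvectionKolyvaginPrimeSupplyAtTwo` (Chebotarev in `ℚ(E[2^k], μ_{2^k})` — on (α)
                             the image of `G_{ℚ(μ_{2^∞})}` is `SL₂(ℤ₂) ∋ τ`, so transposition Kolyvagin primes exist at EVERY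
                             level; provable now modulo a Chebotarev named fact), r1′ the genus identity
                             `KuriharaGenusIdentityTwo.KuriharaGenusIdentityAtTwo` (crux-dir `SketchKolyvaginRigidityTwo.lean`:
                             the level-1 number mod 2 is `(∑ c[a/ℓ]⁺ − ∑ (a/ℓ)·c[a/ℓ]⁺)/2`, Birch's twisted sum — the road to a
                             class-wide proof by congruences for `L(E ⊗ χ_ℓ, 1)`).
COMPOSITION `OrdMissingLowerBoundAtTwo_of` is CLOSED over the five stub NAMES (arrow form `_of_arrows` over the statements,
`ordMissingLowerBoundAtTwo_of_statements` with no sorry at all) and concludes the ROUTE DECL `Theses.ByReductionTypeAtTwo.OrdMissingLowerBoundAtTwo` BY NAME; the algebra «unit cofactor ⇒ `char X = (g)`» and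
the X5 doors are proved here.  Sorries live ONLY in `stub_*`.  Disproof used: none exists for this crux (no
`Disproof.lean`); negatives honoured: stmt-24881 (`not_EquivariantChebotarevAtTwo`: primes are plain Chebotarev classes
over ℚ, no imaginary quadratic field), stmt-15532 (`TamePinch`, CM: `¬ HasCM` kept), X4
`not_kuriharaUnitAt_of_bsdp_of_dvd_tamagawaProduct` (never a UNIT number when `2 ∣ Tam`: Kim's shifted level).
BSD is not proved by any of this; nothing here is a Literature fact.
-/

set_option autoImplicit false
-- the Cruxes namespace of this sub repeats the summit name by design (D-0017 nested layout)
set_option linter.dupNamespace false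

noncomputable section

open scoped Classical MatrixGroups ModularForm

open CongruenceSubgroup WeierstrassCurve Literature.NumberTheory.EllipticCurves
  Literature.NumberTheory.EllipticCurves.ModularForms Literature.NumberTheory.EllipticCurves.Rank1Residual
  Literature.NumberTheory.EllipticCurves.Rank1Residual.Typed
  Literature.NumberTheory.EllipticCurves.Greenberg1999
  Summit.BirchSwinnertonDyer.Rank1Residual.X5
  Summit.BirchSwinnertonDyer.Rank1Residual.X5.O1
  Summit.BirchSwinnertonDyer.Rank1Residual
  Summit.BirchSwinnertonDyer.BirchSwinnertonDyer.Theorems.Rank1ResidualX1Defs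
open Literature.NumberTheory.DiophantineGeometry.Dioph (ratModP)

namespace Summit.BirchSwinnertonDyer.BirchSwinnertonDyer.Cruxes.OrdMissingLowerBoundAtTwo.LambdaKolyvaginRigidityTwo

/-! ## §0 The habitat (α) and the finite certificate -/

/-- **The habitat is the big-image locus.** At a good ordinary `2`, `ρ̄_{E,4}` onto ⟺ `ρ_{E,2^m}` onto for every
`m` (Dokchitser–Dokchitser 2012 (3) + Rouse–Zureick-Brown; tree). This is Mazur–Rubin's (H.2) at `2`: the
transvection `τ` lies in `ρ(G_{ℚ(μ_{2^∞})}) = ρ(G_ℚ) ∩ SL₂(ℤ₂)` iff the 2-adic image is full. -/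
theorem habitat_iff (W : WeierstrassCurve ℚ) [W.IsElliptic] [W.IsGloballyMinimal] (hgo : GoodOrd W 2) :
    W.HasSurjectiveModNGaloisRep 4 ↔ ∀ m : ℕ, W.HasSurjectiveModNGaloisRep ((2 ^ m : ℕ) : ℤ) :=
  (forall_hasSurjectiveModNGaloisRep_two_pow_iff_four_of_good_two W hgo.1).symm

/-- **Transposition prime**: `Frob_ℓ` acts on `E[2]` as a transposition, read off the reduction: the `2`-torsion of
`Ẽ(𝔽_ℓ)` has at most `2` points (so `Ẽ(𝔽_ℓ)[2^∞]` is CYCLIC, and for a level-`k` Kolyvagin prime cyclic of order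
`≥ 2^k`: `E[2^k]/(Frob_ℓ − 1) ≅ ℤ/2^k`, the rank-one local condition of the Kolyvagin-system machine). The `p = 2`
Chebotarev class replacing «`p ≥ 5`». -/
def IsTranspositionPrime (W : WeierstrassCurve ℚ) [W.IsElliptic] [W.IsGloballyMinimal] (ℓ : ℕ) [Fact ℓ.Prime] :
    Prop :=
  Nat.card {P : ((WeierstrassCurve.integralModelInt W).map (Int.castRingHom (ZMod ℓ))).toAffine.Point //
    2 • P = 0} ≤ 2

/-- The `c`-SCALED Kurihara number at `2`: `δ^{(c)}_n = ∑_{a ∈ (ℤ/n)ˣ} \overline{c·[a/n]⁺_f} · ∏_{ℓ ∣ n} ψ_ℓ(a) ∈ ℤ/2^k`.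
The scaling `c ∈ ℚ` (typically `c = 2^e`) repairs the failure at `2` of Kim's standing hypothesis `[r]⁺ ∈ ℤ_(2)`
(half-integral plus symbols, e.g. 563a1): with `c·[r]⁺ ∈ ℤ_(2)` for all `r` the reduction is a ring map and
`δ^{(c)}_n` is lift-independent. For `c = 1` this is literally the tree's `kuriharaNumber f (2^k) n ψ`. -/
def kuriharaNumberScaled {N : ℕ} (f : CuspForm (Gamma0 N) 2) (c : ℚ) (k n : ℕ) [NeZero n]
    (ψ : (ℓ : ℕ) → (ZMod ℓ)ˣ →* Multiplicative (ZMod (2 ^ k))) : ZMod (2 ^ k) :=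
  ∑ a : (ZMod n)ˣ, ratModP (2 ^ k) (c * ratPlusSymbol f (((a : ZMod n).val : ℚ) / n)) *
    ∏ ℓ ∈ n.primeFactors.attach,
      Multiplicative.toAdd (ψ ℓ.1 (ZMod.unitsMap (Nat.dvd_of_mem_primeFactors ℓ.2) a))

/-- Sanity: at `c = 1` the scaled number is the tree's `kuriharaNumber`. -/
theorem kuriharaNumberScaled_one {N : ℕ} (f : CuspForm (Gamma0 N) 2) (k n : ℕ) [NeZero n]
    (ψ : (ℓ : ℕ) → (ZMod ℓ)ˣ →* Multiplicative (ZMod (2 ^ k))) :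
    kuriharaNumberScaled f 1 k n ψ = kuriharaNumber f (2 ^ k) n ψ := by
  simp [kuriharaNumberScaled, kuriharaNumber_def]

/-- **A SHARP Kurihara witness at `2`** for `W` and a weight-2 form `f` (the newform of `W` in use): a scaling
`c ≠ 0` making every plus symbol `2`-integral, a level `1 ≤ k ≤ ord₂(Tam W) + ord₂(c) + 1` (Kim's sharp level,
shifted by the scaling — scale-invariant), a square-free `n ∈ 𝒩_k` (Kato–Kim Kolyvagin primes at `2`: `ℓ ∤ 2N`,
`ℓ ≡ 1`, `a_ℓ ≡ ℓ + 1 (mod 2^k)`) all of whose primes are TRANSPOSITION primes, surjective discrete logarithms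
`ψ_ℓ`, and `δ^{(c)}_n ≠ 0` in `ℤ/2^k`. A FINITE certificate, decidable curve by curve (kit j304439: 7.8 s / 35 curves). -/
def SharpKuriharaWitnessAtTwo (W : WeierstrassCurve ℚ) [W.IsElliptic] [W.IsGloballyMinimal]
    {N : ℕ} (f : CuspForm (Gamma0 N) 2) : Prop :=
  ∃ (c : ℚ) (k n : ℕ) (_ : NeZero n) (ψ : (ℓ : ℕ) → (ZMod ℓ)ˣ →* Multiplicative (ZMod (2 ^ k))),
    c ≠ 0 ∧ (∀ r : ℚ, ‖((c * ratPlusSymbol f r : ℚ) : ℚ_[2])‖ ≤ 1) ∧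
    1 ≤ k ∧ ((k : ℤ) ≤ (padicValNat 2 W.tamagawaProduct : ℤ) + padicValRat 2 c + 1) ∧
    Kato.IsKolyvaginProduct W 2 k n ∧ (∀ (ℓ : ℕ) [Fact ℓ.Prime], ℓ ∣ n → IsTranspositionPrime W ℓ) ∧
    (∀ ℓ ∈ n.primeFactors, Function.Surjective (ψ ℓ)) ∧
    kuriharaNumberScaled f c k n ψ ≠ 0

/-! ## §1 First rungs (typed, NOT stubs of the composition; the lead may register them as sub-stubs) -/

/-- **Rung r1 (triage-1) — transposition Kolyvagin primes exist at EVERY level on (α).** Chebotarev in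
`ℚ(E[2^k], μ_{2^k})/ℚ`: on (α) the image of `G_{ℚ(μ_{2^k})}` on `E[2^k]` is `SL₂(ℤ/2^k)`, which contains the
transvection `τ`; any `ℓ` with `Frob_ℓ ∼ τ` there is `≡ 1 (mod 2^k)`, has `a_ℓ = tr τ = 2 ≡ ℓ + 1` and
`Ẽ(𝔽_ℓ)[2] = ker(τ − 1) mod 2` of order `2`. OFF (α) at level `k ≥ 2` such primes do NOT exist on (γ₂)
(`ℓ ≡ 1 mod 4` fixes `i`, hence `√Δ`: Frobenius is an even permutation of `E[2] ∖ 0`) — kit j304479, 2541a1. -/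
def TransvectionKolyvaginPrimeSupplyAtTwo : Prop :=
  ∀ (W : WeierstrassCurve ℚ) [W.IsElliptic] [W.IsGloballyMinimal], GoodOrd W 2 → W.HasSurjectiveModNGaloisRep 4 →
    ∀ k B : ℕ, 1 ≤ k → ∃ ℓ : ℕ, B < ℓ ∧ ∃ (_ : Fact ℓ.Prime), Kato.IsKolyvaginPrime W 2 k ℓ ∧ IsTranspositionPrime W ℓ

/-- **Rung r2′ — the Tamagawa floor at `2` is EXACT (no witness below Kim's level).** For every admissible
`(c, k, n, ψ)` on (α) with `k ≤ ord₂ Tam + ord₂ c` the scaled Kurihara number VANISHES in `ℤ/2^k` — the `p = 2`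
analogue of X4's `not_kuriharaUnitAt_of_bsdp_of_dvd_tamagawaProduct` (there `p ≥ 5`, from BSD_p) at every
composite level; numerically 0 violations in > 1000 numbers on 35 curves (kit j304439/j304479). This is the
«defect accounting is exact» half of `stub_witnessForcesUnit`: had the floor a `2`-adic leak, a sharp witness
would bound the Λ-defect `d` without killing it. -/
def KuriharaTamagawaFloorAtTwo : Prop :=
  ∀ (W : WeierstrassCurve ℚ) [W.IsElliptic] [W.IsGloballyMinimal], W.analyticRank = 0 → GoodOrd W 2 →
    W.HasSurjectiveModNGaloisRep 4 →
    ∀ [NeZero (W.conductorNorm ℤ)] (f : CuspForm (Gamma0 (W.conductorNorm ℤ)) 2), IsNewformOf W f →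
    ∀ (c : ℚ) (k n : ℕ) [NeZero n] (ψ : (ℓ : ℕ) → (ZMod ℓ)ˣ →* Multiplicative (ZMod (2 ^ k))),
      c ≠ 0 → (∀ r : ℚ, ‖((c * ratPlusSymbol f r : ℚ) : ℚ_[2])‖ ≤ 1) →
      Kato.IsKolyvaginProduct W 2 k n → (∀ (ℓ : ℕ) [Fact ℓ.Prime], ℓ ∣ n → IsTranspositionPrime W ℓ) →
      (∀ ℓ ∈ n.primeFactors, Function.Surjective (ψ ℓ)) →
      ((k : ℤ) ≤ (padicValNat 2 W.tamagawaProduct : ℤ) + padicValRat 2 c) →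
      kuriharaNumberScaled f c k n ψ = 0

/-- Consistency of r2′ with the certificate: under the floor, a sharp witness sits EXACTLY at Kim's level
`k = ord₂ Tam + ord₂ c + 1` (so «sharp» is forced, not chosen). -/
theorem sharpWitness_level_eq_of_floor (hfloor : KuriharaTamagawaFloorAtTwo)
    (W : WeierstrassCurve ℚ) [W.IsElliptic] [W.IsGloballyMinimal] (hr : W.analyticRank = 0) (hgo : GoodOrd W 2)
    (h4 : W.HasSurjectiveModNGaloisRep 4) [NeZero (W.conductorNorm ℤ)] (f : CuspForm (Gamma0 (W.conductorNorm ℤ)) 2)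
    (hf : IsNewformOf W f) {c : ℚ} {k n : ℕ} [NeZero n] {ψ : (ℓ : ℕ) → (ZMod ℓ)ˣ →* Multiplicative (ZMod (2 ^ k))}
    (hc : c ≠ 0) (hint : ∀ r : ℚ, ‖((c * ratPlusSymbol f r : ℚ) : ℚ_[2])‖ ≤ 1)
    (hk : (k : ℤ) ≤ (padicValNat 2 W.tamagawaProduct : ℤ) + padicValRat 2 c + 1)
    (hkol : Kato.IsKolyvaginProduct W 2 k n) (htr : ∀ (ℓ : ℕ) [Fact ℓ.Prime], ℓ ∣ n → IsTranspositionPrime W ℓ)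
    (hψ : ∀ ℓ ∈ n.primeFactors, Function.Surjective (ψ ℓ)) (hne : kuriharaNumberScaled f c k n ψ ≠ 0) :
    (k : ℤ) = (padicValNat 2 W.tamagawaProduct : ℤ) + padicValRat 2 c + 1 := by
  by_contra hlt
  exact hne (hfloor W hr hgo h4 f hf c k n ψ hc hint hkol htr hψ (by omega))

/-! ## §2 The statements of the line (as `Prop`s, so that cards and the lead can cite them by name) -/

/-- RESIDUAL off the habitat: the crux restricted to `¬ ρ̄_{E,4} onto` (strata β ∪ γ₁ ∪ γ₂). Not this line's lever. -/
def OffBigImageLowerBoundAtTwo : Prop :=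
  ∀ (W : WeierstrassCurve ℚ) [W.IsElliptic] [W.IsGloballyMinimal], ¬ W.HasCM → W.analyticRank = 0 →
    GoodOrd W 2 → ¬ W.HasSurjectiveModNGaloisRep 4 → MissingLowerBoundAt W 2

/-- BOOKED Kato half at `W` on (α), integral in Λ (the tree's typed object; = 19271 / 19573·`stub_surj` on ρ̄₄-onto). -/
def KatoDivisibilityBigImageAtTwo : Prop :=
  ∀ (W : WeierstrassCurve ℚ) [W.IsElliptic] [W.IsGloballyMinimal], ¬ W.HasCM → W.analyticRank = 0 →
    GoodOrd W 2 → W.HasSurjectiveModNGaloisRep 4 → MainConjectureLowerDivisibilityAtTwoOrd W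

/-- **THE LEVER — a sharp witness forces a UNIT cofactor.** On (α), non-CM, rank 0, good ordinary 2: for the
cyclotomic data, the newform `f`, `ϖ` with `ϖ·Ω_E = Ω⁺_f`, every dual datum `D` with `char X = (f_X)` and every
`d ∈ Λ` with `ι(f_X · d) = ϖ·L₂(f, α)`: a sharp Kurihara witness for `(W, f)` gives `d ∈ Λˣ`. (Well-posed: `Λ` is a
domain and `ϖ·L₂ ≠ 0` at rank 0, so `d` is determined up to a unit by the data; implied by `MazurMainConjecture W 2`,
and with `KatoDivisibilityBigImageAtTwo` + a witness equivalent to it.) Mazur–Rubin 5.3.10(iii)/Kim Thm 1.1 print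
`p ≥ 5`; nothing at `2`. -/
def SharpWitnessForcesUnitAtTwo : Prop :=
  ∀ (W : WeierstrassCurve ℚ) [W.IsElliptic] [W.IsGloballyMinimal], ¬ W.HasCM → W.analyticRank = 0 →
    GoodOrd W 2 → W.HasSurjectiveModNGaloisRep 4 →
    ∀ (κ : ZpExtension ℚ 2) (γ : Field.absoluteGaloisGroup ℚ),
      κ.IsCyclotomic → κ.IsTopGenerator γ → IsCyclotomicVariable 2 γ →
    ∀ [NeZero (W.conductorNorm ℤ)] (f : CuspForm (Gamma0 (W.conductorNorm ℤ)) 2), IsNewformOf W f →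
    ∀ (ϖ : ℚ), (ϖ : ℝ) * W.realPeriodRat = plusPeriod f →
    ∀ (D : W.SelmerDualData κ γ) (fX d : IwasawaAlgebra 2), D.charIdeal = Ideal.span {fX} →
      iwasawaToPowerSeries 2 (fX * d) = PowerSeries.C (ϖ : ℚ_[2]) * padicLFunction f (unitRoot W 2 : ℚ_[2]) →
      SharpKuriharaWitnessAtTwo W f → IsUnit d

/-- ANALYTIC SUPPLY on (α): every rank-0 curve of the habitat carries a sharp witness for its newform. -/
def SharpWitnessSupplyBigImageAtTwo : Prop :=
  ∀ (W : WeierstrassCurve ℚ) [W.IsElliptic] [W.IsGloballyMinimal], ¬ W.HasCM → W.analyticRank = 0 →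
    GoodOrd W 2 → W.HasSurjectiveModNGaloisRep 4 →
    ∀ [NeZero (W.conductorNorm ℤ)] (f : CuspForm (Gamma0 (W.conductorNorm ℤ)) 2), IsNewformOf W f →
      SharpKuriharaWitnessAtTwo W f

/-! ## §3 Proved glue: unit cofactor ⇒ Mazur's main conjecture at `2` ⇒ the crux at `W` -/

/-- **Kato half + unit-forcing + supply ⇒ `MazurMainConjecture W 2` on (α)** (pure algebra in the UFD `Λ`:
`char X = (f_X)` is principal (`charIdeal_isPrincipal_holds`), Kato gives `g = f_X·d ∈ char X` with `ι g = ϖ·L₂`,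
the witness makes `d` a unit, so `char X = (g)`; torsion is Kato 17.4 (1) AT 2, in print, from PUB). -/
theorem mazurMainConjecture_two_of_stubs_bigImage
    (hPub : Summit.BirchSwinnertonDyer.BirchSwinnertonDyer.Theses.ByReductionTypeAtTwo.OrdPublishedInputsAtTwo)
    (hK : KatoDivisibilityBigImageAtTwo) (hU : SharpWitnessForcesUnitAtTwo) (hS : SharpWitnessSupplyBigImageAtTwo)
    (W : WeierstrassCurve ℚ) [W.IsElliptic] [W.IsGloballyMinimal] (hcm : ¬ W.HasCM) (hr : W.analyticRank = 0)
    (hgo : GoodOrd W 2) (h4 : W.HasSurjectiveModNGaloisRep 4) : MazurMainConjecture W 2 := by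
  have hPub' := hPub
  obtain ⟨-, -, h17, -⟩ := hPub'
  have hord : IsOrdinaryAt W 2 := hgo
  intro κ γ hκ hγ hγ' _ f hf ϖ hϖ D
  have htor : D.IsTorsion := (h17 W f κ γ hκ hγ hγ' hord hf D).1
  obtain ⟨g, hg, hι⟩ := hK W hcm hr hgo h4 κ γ hκ hγ hγ' hord f hf ϖ hϖ D
  obtain ⟨fX, hfX⟩ := (charIdeal_isPrincipal_holds 2 D.X).principal
  have hfX' : D.charIdeal = Ideal.span {fX} := hfX
  rw [hfX'] at hg
  obtain ⟨d, hd⟩ := Ideal.mem_span_singleton'.mp hg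
  -- `hd : d * fX = g`
  have hιd : iwasawaToPowerSeries 2 (fX * d) =
      PowerSeries.C (ϖ : ℚ_[2]) * padicLFunction f (unitRoot W 2 : ℚ_[2]) := by
    rw [mul_comm, hd, hι]
  have hu : IsUnit d :=
    hU W hcm hr hgo h4 κ γ hκ hγ hγ' f hf ϖ hϖ D fX d hfX' hιd (hS W hcm hr hgo h4 f hf)
  refine ⟨htor, g, ?_, hι⟩
  rw [hfX', ← hd]
  exact (Ideal.span_singleton_mul_left_unit hu fX).symm

/-- **`MissingLowerBoundAt W 2` on (α) from the four non-residual stubs**, through the X5 doors. -/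
theorem missingLowerBoundAt_two_of_stubs_bigImage
    (hPub : Summit.BirchSwinnertonDyer.BirchSwinnertonDyer.Theses.ByReductionTypeAtTwo.OrdPublishedInputsAtTwo)
    (hK : KatoDivisibilityBigImageAtTwo) (hU : SharpWitnessForcesUnitAtTwo) (hS : SharpWitnessSupplyBigImageAtTwo)
    (W : WeierstrassCurve ℚ) [W.IsElliptic] [W.IsGloballyMinimal] (hcm : ¬ W.HasCM) (hr : W.analyticRank = 0)
    (hgo : GoodOrd W 2) (h4 : W.HasSurjectiveModNGaloisRep 4) : MissingLowerBoundAt W 2 := by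
  have hPub' := hPub
  obtain ⟨hmod, hGZK, h17, hGr⟩ := hPub'
  exact missingLowerBoundAt_two_of_eisenstein_of_kato W (twoAdicEulerCharRankZero_zero_of_greenberg W hGr)
    hmod hGZK (h17 W) hr hgo
    (mainConjectureEisensteinDivisibilityAtTwo_of_mazurMainConjecture W
      (fun _ => mazurMainConjecture_two_of_stubs_bigImage hPub hK hU hS W hcm hr hgo h4))

/-- **The crux from the five statements** (habitat dichotomy `ρ̄_{E,4}` onto / not). -/
theorem ordMissingLowerBoundAtTwo_of_statements
    (hPub : Summit.BirchSwinnertonDyer.BirchSwinnertonDyer.Theses.ByReductionTypeAtTwo.OrdPublishedInputsAtTwo)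
    (hOff : OffBigImageLowerBoundAtTwo) (hK : KatoDivisibilityBigImageAtTwo) (hU : SharpWitnessForcesUnitAtTwo)
    (hS : SharpWitnessSupplyBigImageAtTwo) :
    Summit.BirchSwinnertonDyer.BirchSwinnertonDyer.Theses.ByReductionTypeAtTwo.OrdMissingLowerBoundAtTwo := by
  show Summit.BirchSwinnertonDyer.BirchSwinnertonDyer.Theorems.OrdHalvesAtTwo.OrdMissingLowerBoundAtTwo
  intro W _ _ hcm hr hgo
  by_cases h4 : W.HasSurjectiveModNGaloisRep 4
  · exact missingLowerBoundAt_two_of_stubs_bigImage hPub hK hU hS W hcm hr hgo h4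
  · exact hOff W hcm hr hgo h4

/-! ## §4 The five stubs (sorries live ONLY here) -/

/-- stub PUB (BY NAME: K4 item 19149; print — modularity, Gross–Zagier–Kolyvagin, Kato 17.4 (1)(2) at every prime
incl. 2, Greenberg 4.1 at 2). -/
theorem stub_pub :
    Summit.BirchSwinnertonDyer.BirchSwinnertonDyer.Theses.ByReductionTypeAtTwo.OrdPublishedInputsAtTwo := by
  sorry

/-- stub OFF-HABITAT RESIDUAL (`ρ̄_{E,4}` not onto: rational 2-torsion, or `C₃` image, or `Δ ∈ −ℚ^{×2}`): the crux
there, owned by the sandwich / GV-analytic / theta / dihedral lines and (γ₂ only) the budget form of this lever. -/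
theorem stub_offBigImage : OffBigImageLowerBoundAtTwo := by
  sorry

/-- stub KATO HALF AT `W` ON (α), INTEGRAL (booked: `X5.O1.MainConjectureLowerDivisibilityAtTwoOrd W`; Kato 17.4 (3)
prints `p ≠ 2`; shared with crux 19573's `stub_surj`). -/
theorem stub_katoCofactor : KatoDivisibilityBigImageAtTwo := by
  sorry

/-- stub THE LEVER (hardest): a sharp Kurihara witness forces the cofactor of `char X` in `ϖ·L₂` to be a unit of
`Λ` — Mazur–Rubin/Kim rigidity at `p = 2` with bounded defects. -/
theorem stub_witnessForcesUnit : SharpWitnessForcesUnitAtTwo := by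
  sorry

/-- stub ANALYTIC SUPPLY on (α): a sharp witness exists for every rank-0 curve of the habitat (28/28 numerically). -/
theorem stub_supply : SharpWitnessSupplyBigImageAtTwo := by
  sorry

/-! ## §5 The composition (CLOSED over the five stub NAMES; concludes the ROUTE DECL by name) -/

/-- **19577 ⟸ PUB ∧ off-habitat residual ∧ Kato half on (α) ∧ unit-forcing ∧ supply** — the ONLY theorem of this
file concluding the crux from the stubs, closed over the registered obligations BY NAME (the form the skeleton
checker admits; cf. `Lines/birth.lean` v2). -/
theorem OrdMissingLowerBoundAtTwo_of :
    Summit.BirchSwinnertonDyer.BirchSwinnertonDyer.Theses.ByReductionTypeAtTwo.OrdMissingLowerBoundAtTwo :=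
  ordMissingLowerBoundAtTwo_of_statements stub_pub stub_offBigImage stub_katoCofactor stub_witnessForcesUnit
    stub_supply

/-- The same in arrow form over the five stub STATEMENTS (crux-plan letter; no stub name used). -/
theorem OrdMissingLowerBoundAtTwo_of_arrows :
    Summit.BirchSwinnertonDyer.BirchSwinnertonDyer.Theses.ByReductionTypeAtTwo.OrdPublishedInputsAtTwo →
    OffBigImageLowerBoundAtTwo → KatoDivisibilityBigImageAtTwo → SharpWitnessForcesUnitAtTwo →
    SharpWitnessSupplyBigImageAtTwo →
    Summit.BirchSwinnertonDyer.BirchSwinnertonDyer.Theses.ByReductionTypeAtTwo.OrdMissingLowerBoundAtTwo :=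
  ordMissingLowerBoundAtTwo_of_statements

end Summit.BirchSwinnertonDyer.BirchSwinnertonDyer.Cruxes.OrdMissingLowerBoundAtTwo.LambdaKolyvaginRigidityTwo

end
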